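import Summits.BirchSwinnertonDyer.Rank1Residual.O5.CoordinateLagrangianLemma
import HarnessLib

/-!
# The depth index law at level `p^k` (o5-r2 GEN 15; the (α) skeleton of R1♯ `DepthLawThree`) — PROVED, abstract

PLACEMENT (typer of record cc-typer-5 GEN 16; o5-r2 GEN 15 LAST ask A-O5-G15-5, HOME/INBOX.md 2026-08-22T15:21:08Z l.12447; DOCKETED
by cc-lead ⟦gen64⟧ (2′) as (c27e) with the BUILD-DEPENDENCY condition): (A) source FROZEN `HOME/b2b-bsdres-o5-r2/gen15/lean/DepthIndexLaw.lean`
sha16 `90198f4a80f5e476` (162 l.; freeze of record = cc-lead GEN 64's re-hash; re-hashed by the typer right before writing = MATCH); it imports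
cc-eng-5 GEN 43's LANDED S1 file `O5/CoordinateLagrangianLemma.lean` (p331932; `coordinateLagrangian_of_odd` / `coordSubgroup`) — NOT inlined,
no duplicate of S1 in the tree; the IMPORT FORM builds on the farm (`lean check` rc 0 / 0 warnings / 0 sorries by the typer, 2026-08-22 16:06Z —
o5-r2's own rc 0 was on the S1-inlined scratch cd533f1e09452129); (B) ALL decl blocks byte-identical (2 defs `fAxis` / `tAxis` + 9 theorems
incl. `depthIndexLaw` / `depthIndexLaw_of_depth`; 0 proof repairs) — typer edits = this paragraph + FOUR one-line docstrings for `lint.docstring`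
(`mem_fAxis`, `mem_tAxis`, `card_zmultiples_prod_bot`, `card_bot_prod_zmultiples`; statements / proofs untouched); namespace `…O5.DepthIndexLaw`;
(E) `@[conjecture]` 0, sorry 0, 0 Literature facts, net named-fact debt 0.  (D) FRAMING: ABSTRACT theorems over `ZMod (p^k)` with ONE displayed
global hypothesis (Poitou–Tate: `loc(Srel)` is a Lagrangian); nothing is asserted about curves — the arithmetic statements it skeletonises
(R1♯ `DepthLawThree` clauses (B)–(E), `O5/DepthLawThree.lean`, (c27a)) stay EVIDENCE-labelled THEOREM-CANDIDATES there; census DEPTH9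
(kit j164292, census-lead G-34 FINAL 'R1♯ SURVIVES on this census') = EVIDENCE, never a Literature fact; the parity / Cassels–Tate split of
`#` into rank and Ш is NOT here (o5-r2); nothing is imported into a class row by this landing.  LANE CLASS-CLOSURE: research route; nothing
booked; no mark of `RESIDUAL-MAP.md` moves; O5 OPEN.

HONEST FRAMING: theorems only; nothing asserted about curves.  Abstract skeleton of `gen15/R1SHARP-DERIVATION.md` §2–§3 at an
arbitrary level `p^k`, `p` odd, on top of the landed S1 (`coordinateLagrangian_of_odd`, cc-eng-5 GEN 43): a global group `H`
(think `H¹(ℚ_S/ℚ, C[p^k])`), the localisation `loc : H →+ R × R` at the level-raising prime `q` (`R = ZMod (p^k)`, first axis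
= the finite / Kummer condition `F` of `C`, second axis = the transverse condition `T` of `G`, hyperbolic pairing
`x y' + x' y` = the local Tate pairing in adapted bases), a relaxed Selmer group `Srel ≤ H` (conditions imposed everywhere except
at `q`), and the ONE global input — POITOU–TATE: the image `loc(Srel)` is a LAGRANGIAN (totally isotropic of order `p^k`).
CONCLUSION (`depthIndexLaw`): there is a depth `δ ≤ k` with `loc(Srel) = p^δ R × p^(k−δ) R`, the `F`-Selmer classes localise onto
`p^δ R × 0`, and the indices of the strict Selmer group are `[Sel_F : Sel_strict] = p^(k−δ)`, `[Sel_T : Sel_strict] = p^δ` — so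
`#Sel_T = #Sel_F · p^(2δ−k)`: with `Sel_F = Sel_{p^k}(C) ≅ ℤ/p^k` generated by a point of exact local depth `d` this is `δ = d` and
`#Sel_{p^k}(G) = p^{2d}` (R1♯ clauses (B)/(D), census DEPTH9 P2/P4, 0 exceptions), and `δ = k` (everything strict) gives
`#Sel_{p^k}(G) = p^k · #Sel_strict` (clauses (C)/(E)).  The parity / Cassels–Tate input that splits `#` into rank and `Ш` is NOT here.
-/

namespace Summit.BirchSwinnertonDyer.Rank1Residual.O5

namespace DepthIndexLaw

open CoordinateLagrangian

variable {p k : ℕ} {H : Type*} [AddCommGroup H]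

/-- The `F`-axis `R × 0` (the finite / Kummer local condition in adapted coordinates). -/
def fAxis (p k : ℕ) : AddSubgroup (ZMod (p ^ k) × ZMod (p ^ k)) := (⊤ : AddSubgroup _).prod ⊥

/-- The `T`-axis `0 × R` (the transverse local condition). -/
def tAxis (p k : ℕ) : AddSubgroup (ZMod (p ^ k) × ZMod (p ^ k)) := (⊥ : AddSubgroup _).prod ⊤

/-- Membership in the `F`-axis: second coordinate zero. [folklore] -/
theorem mem_fAxis (x : ZMod (p ^ k) × ZMod (p ^ k)) : x ∈ fAxis p k ↔ x.2 = 0 := by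
  simp [fAxis, AddSubgroup.mem_prod]

/-- Membership in the `T`-axis: first coordinate zero. [folklore] -/
theorem mem_tAxis (x : ZMod (p ^ k) × ZMod (p ^ k)) : x ∈ tAxis p k ↔ x.1 = 0 := by
  simp [tAxis, AddSubgroup.mem_prod]

/-- The localisations of the `F`-Selmer classes: `loc(Srel ∩ loc⁻¹ F) = loc(Srel) ∩ F`. [folklore] -/
theorem map_inf_comap_eq (loc : H →+ ZMod (p ^ k) × ZMod (p ^ k)) (Srel : AddSubgroup H)
    (L : AddSubgroup (ZMod (p ^ k) × ZMod (p ^ k))) :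
    (Srel ⊓ L.comap loc).map loc = Srel.map loc ⊓ L := by
  ext y
  simp only [AddSubgroup.mem_map, AddSubgroup.mem_inf, AddSubgroup.mem_comap]
  constructor
  · rintro ⟨x, ⟨hxS, hxL⟩, rfl⟩
    exact ⟨⟨x, hxS, rfl⟩, hxL⟩
  · rintro ⟨⟨x, hxS, rfl⟩, hyL⟩
    exact ⟨x, ⟨hxS, hyL⟩, rfl⟩

/-- `C_δ ∩ (R × 0) = p^δ R × 0`. [folklore] -/
theorem coordSubgroup_inf_fAxis (δ : ℕ) :
    coordSubgroup p k δ ⊓ fAxis p k = (AddSubgroup.zmultiples ((p ^ δ : ℕ) : ZMod (p ^ k))).prod ⊥ := by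
  ext x
  rw [AddSubgroup.mem_inf, mem_coordSubgroup_iff, mem_fAxis, AddSubgroup.mem_prod, mem_zmultiples_iff_dvd,
    AddSubgroup.mem_bot]
  constructor
  · rintro ⟨⟨h1, -⟩, h2⟩
    exact ⟨h1, h2⟩
  · rintro ⟨h1, h2⟩
    exact ⟨⟨h1, by rw [h2]; exact dvd_zero _⟩, h2⟩

/-- `C_δ ∩ (0 × R) = 0 × p^(k−δ) R`. [folklore] -/
theorem coordSubgroup_inf_tAxis (δ : ℕ) :
    coordSubgroup p k δ ⊓ tAxis p k = (⊥ : AddSubgroup (ZMod (p ^ k))).prod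
      (AddSubgroup.zmultiples ((p ^ (k - δ) : ℕ) : ZMod (p ^ k))) := by
  ext x
  rw [AddSubgroup.mem_inf, mem_coordSubgroup_iff, mem_tAxis, AddSubgroup.mem_prod, mem_zmultiples_iff_dvd,
    AddSubgroup.mem_bot]
  constructor
  · rintro ⟨⟨-, h2⟩, h1⟩
    exact ⟨h1, h2⟩
  · rintro ⟨h1, h2⟩
    exact ⟨⟨by rw [h1]; exact dvd_zero _, h2⟩, h1⟩

/-- `#(p^δ R × 0) = p^(k−δ)` in `R × R`, `R = ℤ/p^k`. [folklore] -/
theorem card_zmultiples_prod_bot (hp : p.Prime) {δ : ℕ} (hδ : δ ≤ k) :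
    Nat.card ((AddSubgroup.zmultiples ((p ^ δ : ℕ) : ZMod (p ^ k))).prod (⊥ : AddSubgroup (ZMod (p ^ k)))) =
      p ^ (k - δ) := by
  rw [Nat.card_congr (AddSubgroup.prodEquiv _ _).toEquiv, Nat.card_prod, card_zmultiples_pow hp hδ,
    AddSubgroup.card_bot, mul_one]

/-- `#(0 × p^(k−δ) R) = p^δ` in `R × R`, `R = ℤ/p^k`. [folklore] -/
theorem card_bot_prod_zmultiples (hp : p.Prime) {δ : ℕ} (hδ : δ ≤ k) :
    Nat.card ((⊥ : AddSubgroup (ZMod (p ^ k))).prod (AddSubgroup.zmultiples ((p ^ (k - δ) : ℕ) : ZMod (p ^ k)))) =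
      p ^ δ := by
  rw [Nat.card_congr (AddSubgroup.prodEquiv _ _).toEquiv, Nat.card_prod, card_zmultiples_pow hp (Nat.sub_le k δ),
    AddSubgroup.card_bot, one_mul, Nat.sub_sub_self hδ]

/-- **The depth index law (abstract R1♯ skeleton at level `p^k`, `p` odd, `k ≥ 1`).**  If the relaxed Selmer group
localises onto a LAGRANGIAN of the hyperbolic plane `R × R` (Poitou–Tate; the hypothesis), then for a unique depth `δ ≤ k`:
`loc(Srel) = C_δ = p^δ R × p^(k−δ) R`, the `F`-Selmer classes localise onto `p^δ R × 0`, the `T`-Selmer classes onto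
`0 × p^(k−δ) R`, and the indices over the strict Selmer group `Srel ∩ ker loc` are `[Sel_F : strict] = p^(k−δ)` and
`[Sel_T : strict] = p^δ` (so `#Sel_T · p^(k−δ) = #Sel_F · p^δ` when finite). [folklore] -/
theorem depthIndexLaw (hp : p.Prime) (hp2 : p ≠ 2) (hk : 1 ≤ k)
    (loc : H →+ ZMod (p ^ k) × ZMod (p ^ k)) (Srel : AddSubgroup H)
    (hiso : IsIsotropicSubgroup (p ^ k) (Srel.map loc)) (hcard : Nat.card (Srel.map loc) = p ^ k) :
    ∃ δ, δ ≤ k ∧ Srel.map loc = coordSubgroup p k δ ∧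
      (Srel ⊓ (fAxis p k).comap loc).map loc = (AddSubgroup.zmultiples ((p ^ δ : ℕ) : ZMod (p ^ k))).prod ⊥ ∧
      (Srel ⊓ (tAxis p k).comap loc).map loc =
        (⊥ : AddSubgroup (ZMod (p ^ k))).prod (AddSubgroup.zmultiples ((p ^ (k - δ) : ℕ) : ZMod (p ^ k))) ∧
      loc.ker.relIndex (Srel ⊓ (fAxis p k).comap loc) = p ^ (k - δ) ∧
      loc.ker.relIndex (Srel ⊓ (tAxis p k).comap loc) = p ^ δ := by
  obtain ⟨δ, hδ, hA⟩ :=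
    (isIsotropic_and_card_eq_iff_exists_eq_coordSubgroup hp hp2 hk (Srel.map loc)).1 ⟨hiso, hcard⟩
  have hF : (Srel ⊓ (fAxis p k).comap loc).map loc =
      (AddSubgroup.zmultiples ((p ^ δ : ℕ) : ZMod (p ^ k))).prod ⊥ := by
    rw [map_inf_comap_eq, hA, coordSubgroup_inf_fAxis]
  have hT : (Srel ⊓ (tAxis p k).comap loc).map loc =
      (⊥ : AddSubgroup (ZMod (p ^ k))).prod (AddSubgroup.zmultiples ((p ^ (k - δ) : ℕ) : ZMod (p ^ k))) := by
    rw [map_inf_comap_eq, hA, coordSubgroup_inf_tAxis]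
  refine ⟨δ, hδ, hA, hF, hT, ?_, ?_⟩
  · rw [AddSubgroup.relIndex_ker, hF, card_zmultiples_prod_bot hp hδ]
  · rw [AddSubgroup.relIndex_ker, hT, card_bot_prod_zmultiples hp hδ]

/-- **Reading the depth off the `F`-side.**  In the situation of `depthIndexLaw`, if some `F`-Selmer class localises to
`(p^d · u, 0)` with `u` a unit and every `F`-Selmer class localises into `p^d R × 0` (e.g. `Sel_F` cyclic, generated by a
class of exact local depth `d ≤ k`), then `δ = d`: `[Sel_T : strict] = p^d` and `[Sel_F : strict] = p^(k−d)`. [folklore] -/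
theorem depthIndexLaw_of_depth (hp : p.Prime) (hp2 : p ≠ 2) (hk : 1 ≤ k)
    (loc : H →+ ZMod (p ^ k) × ZMod (p ^ k)) (Srel : AddSubgroup H)
    (hiso : IsIsotropicSubgroup (p ^ k) (Srel.map loc)) (hcard : Nat.card (Srel.map loc) = p ^ k)
    {d : ℕ} (hd : d ≤ k)
    (hgen : ∃ x ∈ Srel, ∃ u : ZMod (p ^ k), IsUnit u ∧ loc x = (((p ^ d : ℕ) : ZMod (p ^ k)) * u, 0))
    (hall : ∀ x ∈ Srel, (loc x).2 = 0 → ((p ^ d : ℕ) : ZMod (p ^ k)) ∣ (loc x).1) :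
    loc.ker.relIndex (Srel ⊓ (fAxis p k).comap loc) = p ^ (k - d) ∧
    loc.ker.relIndex (Srel ⊓ (tAxis p k).comap loc) = p ^ d := by
  haveI : NeZero (p ^ k) := ⟨pow_ne_zero _ hp.ne_zero⟩
  obtain ⟨δ, hδ, hA, hF, -, hiF, hiT⟩ := depthIndexLaw hp hp2 hk loc Srel hiso hcard
  -- δ = d: the generator shows p^δ ∣ p^d u (so δ ≤ d), and (p^δ, 0) ∈ loc(Sel_F) shows p^d ∣ p^δ (so d ≤ δ)
  obtain ⟨x, hxS, u, hu, hx⟩ := hgen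
  have hxF : loc x ∈ (Srel ⊓ (fAxis p k).comap loc).map loc := by
    refine ⟨x, ⟨hxS, ?_⟩, rfl⟩
    change x ∈ (fAxis p k).comap loc
    rw [AddSubgroup.mem_comap, mem_fAxis, hx]
  rw [hF, AddSubgroup.mem_prod, mem_zmultiples_iff_dvd, hx] at hxF
  have h1 : ((p ^ δ : ℕ) : ZMod (p ^ k)) ∣ ((p ^ d : ℕ) : ZMod (p ^ k)) := by
    have := hxF.1
    rwa [hu.dvd_mul_right] at this
  have hmem : ((((p ^ δ : ℕ) : ZMod (p ^ k))), (0 : ZMod (p ^ k))) ∈ (Srel ⊓ (fAxis p k).comap loc).map loc := by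
    rw [hF, AddSubgroup.mem_prod, mem_zmultiples_iff_dvd]
    exact ⟨dvd_refl _, (⊥ : AddSubgroup (ZMod (p ^ k))).zero_mem⟩
  obtain ⟨y, ⟨hyS, hyF⟩, hy⟩ := hmem
  have h2 : ((p ^ d : ℕ) : ZMod (p ^ k)) ∣ ((p ^ δ : ℕ) : ZMod (p ^ k)) := by
    have := hall y hyS (by rw [hy]); rwa [hy] at this
  -- divisibility of prime powers in ZMod (p^k) with both exponents ≤ k forces equality of exponents
  have key : ∀ {a b : ℕ}, a ≤ k → b ≤ k → ((p ^ a : ℕ) : ZMod (p ^ k)) ∣ ((p ^ b : ℕ) : ZMod (p ^ k)) → a ≤ b := by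
    intro a b ha hb hab
    by_contra hlt
    push Not at hlt
    -- then p^a ∣ p^b in ZMod (p^k) gives p^a ∣ p^b + m p^k in ℕ-terms: use cardinalities of zmultiples instead
    have hsub : AddSubgroup.zmultiples ((p ^ b : ℕ) : ZMod (p ^ k)) ≤ AddSubgroup.zmultiples ((p ^ a : ℕ) : ZMod (p ^ k)) := by
      rw [AddSubgroup.zmultiples_le, mem_zmultiples_iff_dvd]; exact hab
    have hc := AddSubgroup.card_le_of_le hsub
    rw [card_zmultiples_pow hp hb, card_zmultiples_pow hp ha] at hc
    have : k - b ≤ k - a := (Nat.pow_le_pow_iff_right hp.one_lt).1 hc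
    omega
  have hδd : δ = d := le_antisymm (key hδ hd h1) (key hd hδ h2)
  subst hδd
  exact ⟨hiF, hiT⟩

end DepthIndexLaw

end Summit.BirchSwinnertonDyer.Rank1Residual.O5
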